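import Literature.Probability.RandomPlanarGeometry.SAWPulledLargeForceExpansionZdLinearRadius
import HarnessLib

/-!
# An explicit, dimension-uniform Ornstein–Zernike rate for pulled bridges on `ℤ^{d+1}`:
# `|Z^B_n(y) e^{−nλ_B(y)} − 1/m(y)| ≤ (6/5)·(12√((2d+1)/y))ⁿ` for every `n`, every `y ≥ 144(2d+1)`, every `d`

Topic `Literature/Probability/RandomPlanarGeometry` (a corollary leaf over `SAWPulledLargeForceExpansionZdLinearRadius.lean` — the LINEAR
geometric envelope `pulledBlockLaw_le_geometric_linear : p_i(y) ≤ √(y/(2d+1))·(2√((2d+1)/y))^i` and the renewal gap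
`pulledGap_linear` (pulled Kesten relation + finite mean block length for `y > 4(2d+1)`) — and `SAWPulledRenewalGap.lean` —
`abs_pulledAmp_sub_inv_le_of`, the every-dimension Ornstein–Zernike rate CONDITIONAL on the relation, the mean and the values `G < 1`,
`H` of the two tail series (`Renewal.abs_sub_inv_tsum_le`, Madras–Slade Theorem 4.2.5 made explicit)).

Here the condition is DISCHARGED in every dimension with explicit constants: for `y ≥ 144(2d+1)` put `q = (2d+1)/y`
(`√q ≤ 1/12`), `r = 2√q ≤ 1/6`, `ρ = 1/(6r) ≥ 1`.  The tails `t_j = 1 − Σ_{k<j} p_k = Σ_{k≥j} p_k` are `≤ (6/5)·√(y/(2d+1))·r^j`,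
so the two series of `abs_pulledAmp_sub_inv_le_of` at the radius `ρ` have `G ≤ 12/25`, `H ≤ 3/5`, and the mean block length is `≥ 1`:

* ★★★ **`abs_pulledAmp_sub_inv_le_linear (d) (hy : 144(2d+1) ≤ y) (n) :
  |a_n(y) − 1/m(y)| ≤ (6/5)·(12√((2d+1)/y))ⁿ`** with `a_n(y) = Z^B_n(y)e^{−nλ_B(y)}` (`pulledAmp`), `m(y) = Σ_i i·p_i(y)`
  (`pulledMeanBlock`) — an EXPLICIT exponential rate of the renewal (Ornstein–Zernike) asymptotics of pulled bridges, uniform in the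
  dimension, improving with the force (`12√((2d+1)/y) → 0`); `one_le_pulledMeanBlock_linear`, `pulledTail_le_linear`.

Printed status: Madras–Slade (1993) Theorem 4.2.5 gives `|a_n − 1/m| ≤ e^{−εn}` with an inexplicit `ε` (residue argument) for the unpulled
renewal; the planar pulled chain of this lane certified windows at fixed `y`; an explicit rate uniform in `d` and `y` is, to our knowledge, not
in print.  Provenance: lane «pcv-sawmu», a-p3 g26 (2026-08-28).  PURE STD, no data, no `decide`.
-/

noncomputable section

open Finset Filter Topology
open scoped BigOperators
open Literature.Probability.LatticeModels
open Literature.Probability.RandomPlanarGeometry.SAW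

namespace Literature.Probability.RandomPlanarGeometry.SAW.Zd

/-- `m(y) ≥ 1` whenever the pulled Kesten relation holds: `Σ_i i·p_i ≥ Σ_i p_i = 1` (`p_0 = 0`).
[cite: MadrasSlade1993, §4.2, eq. (4.2.15)–(4.2.16) (p. 93, 2013 reprint)] -/
theorem one_le_pulledMeanBlock_linear (d : ℕ) {y : ℝ} (hy : 4 * (2 * d + 1 : ℝ) < y) :
    1 ≤ pulledMeanBlock (d + 1) y := by
  have hD : (0 : ℝ) ≤ 2 * d + 1 := by positivity
  have hy0 : 0 < y := by linarith
  obtain ⟨hK, hM, -, -⟩ := pulledGap_linear d hy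
  rw [pulledMeanBlock, ← hK.tsum_eq]
  refine (hK.summable).tsum_le_tsum (fun i => ?_) hM
  rcases Nat.eq_zero_or_pos i with rfl | hi
  · simp [pulledBlockLaw_zero]
  · have h1 : (1 : ℝ) ≤ i := by exact_mod_cast hi
    have hp := pulledBlockLaw_nonneg (d := d + 1) hy0.le i
    nlinarith

/-- **Linear tail envelope**: for `y ≥ 144(2d+1)` (so `r = 2√((2d+1)/y) ≤ 1/6`) and every `j`,
`1 − Σ_{k<j} p_k(y) = Σ_{k≥j} p_k(y) ≤ (6/5)·√(y/(2d+1))·rʲ`. [cite: MadrasSlade1993, Theorem 4.2.5 and Appendix B] -/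
theorem pulledTail_le_linear (d : ℕ) {y : ℝ} (hy : 144 * (2 * d + 1 : ℝ) ≤ y) (j : ℕ) :
    0 ≤ 1 - ∑ k ∈ range j, pulledBlockLaw (d + 1) y k ∧
      1 - ∑ k ∈ range j, pulledBlockLaw (d + 1) y k
        ≤ (6 / 5) * (Real.sqrt ((2 * d + 1) / y))⁻¹ * (2 * Real.sqrt ((2 * d + 1) / y)) ^ j := by
  have hD : (0 : ℝ) < 2 * d + 1 := by positivity
  have hy0 : 0 < y := by linarith
  have hy4 : 4 * (2 * d + 1 : ℝ) < y := by linarith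
  have hy1 : (2 * d + 1 : ℝ) ≤ y := by linarith
  obtain ⟨hK, -, -, -⟩ := pulledGap_linear d hy4
  have hs12 : Real.sqrt ((2 * d + 1) / y) ≤ 1 / 12 := by
    have hq : (2 * d + 1) / y ≤ (1 / 12) ^ 2 := by rw [div_le_iff₀ hy0]; nlinarith
    calc Real.sqrt ((2 * d + 1) / y) ≤ Real.sqrt ((1 / 12) ^ 2) := Real.sqrt_le_sqrt hq
      _ = 1 / 12 := Real.sqrt_sq (by norm_num)
  have henv : ∀ i, pulledBlockLaw (d + 1) y i
      ≤ (Real.sqrt ((2 * d + 1) / y))⁻¹ * (2 * Real.sqrt ((2 * d + 1) / y)) ^ i :=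
    fun i => pulledBlockLaw_le_geometric_linear d hy1 i
  obtain ⟨s, hs0, hs12, hsq⟩ : ∃ s : ℝ, 0 < s ∧ s ≤ 1 / 12 ∧ Real.sqrt ((2 * d + 1) / y) = s :=
    ⟨_, Real.sqrt_pos.2 (by positivity), hs12, rfl⟩
  rw [hsq] at henv ⊢
  obtain ⟨r, hr⟩ : ∃ r : ℝ, 2 * s = r := ⟨_, rfl⟩
  rw [hr] at henv ⊢
  have hr0 : 0 ≤ r := by rw [← hr]; positivity
  have hr6 : r ≤ 1 / 6 := by rw [← hr]; linarith
  -- the tail as a `tsum`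
  have htail : 1 - ∑ k ∈ range j, pulledBlockLaw (d + 1) y k = ∑' k, pulledBlockLaw (d + 1) y (k + j) := by
    rw [← hK.tsum_eq, ← hK.summable.sum_add_tsum_nat_add j]; ring
  have hgeo : HasSum (fun k : ℕ => s⁻¹ * r ^ j * r ^ k) (s⁻¹ * r ^ j * (1 - r)⁻¹) :=
    (hasSum_geometric_of_lt_one hr0 (by linarith)).mul_left _
  have hle : ∀ k, pulledBlockLaw (d + 1) y (k + j) ≤ s⁻¹ * r ^ j * r ^ k := fun k => by
    calc pulledBlockLaw (d + 1) y (k + j) ≤ s⁻¹ * r ^ (k + j) := henv (k + j)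
      _ = s⁻¹ * r ^ j * r ^ k := by rw [pow_add]; ring
  have hsum : Summable fun k => pulledBlockLaw (d + 1) y (k + j) := (summable_nat_add_iff j).2 hK.summable
  refine ⟨?_, ?_⟩
  · rw [htail]; exact tsum_nonneg fun k => pulledBlockLaw_nonneg hy0.le _
  · rw [htail]
    calc ∑' k, pulledBlockLaw (d + 1) y (k + j) ≤ ∑' k, s⁻¹ * r ^ j * r ^ k := hsum.tsum_le_tsum hle hgeo.summable
      _ = s⁻¹ * r ^ j * (1 - r)⁻¹ := hgeo.tsum_eq
      _ ≤ s⁻¹ * r ^ j * (6 / 5) := by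
          refine mul_le_mul_of_nonneg_left ?_ (by positivity)
          rw [inv_le_comm₀ (by linarith) (by norm_num)]; linarith
      _ = (6 / 5) * s⁻¹ * r ^ j := by ring

/-- ★★★ **EXPLICIT ORNSTEIN–ZERNIKE RATE FOR PULLED BRIDGES, EVERY DIMENSION**: for every `d`, every `y ≥ 144(2d+1)` and every `n`,
`|a_n(y) − 1/m(y)| ≤ (6/5)·(12√((2d+1)/y))ⁿ`, where `a_n(y) = Z^B_n(y) e^{−nλ_B(y)}` and `m(y) = Σ_i i·p_i(y)` is the mean block length
(tails at the radius `ρ = 1/(12√((2d+1)/y)) ≥ 1`: `G ≤ 12/25`, `H ≤ 3/5`, `m ≥ 1` in `abs_pulledAmp_sub_inv_le_of`).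
[cite: MadrasSlade1993, Theorem 4.2.5 and Appendix B, (B.5)] [cite: Beaton2015, §3, Lemma 2] -/
theorem abs_pulledAmp_sub_inv_le_linear (d : ℕ) {y : ℝ} (hy : 144 * (2 * d + 1 : ℝ) ≤ y) (n : ℕ) :
    |pulledAmp (d + 1) y n - (pulledMeanBlock (d + 1) y)⁻¹| ≤ (6 / 5) * (12 * Real.sqrt ((2 * d + 1) / y)) ^ n := by
  have hD : (0 : ℝ) < 2 * d + 1 := by positivity
  have hy0 : 0 < y := by linarith
  have hy4 : 4 * (2 * d + 1 : ℝ) < y := by linarith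
  obtain ⟨hK, hM, -, -⟩ := pulledGap_linear d hy4
  have htail := pulledTail_le_linear d hy
  have hs12 : Real.sqrt ((2 * d + 1) / y) ≤ 1 / 12 := by
    have hq : (2 * d + 1) / y ≤ (1 / 12) ^ 2 := by rw [div_le_iff₀ hy0]; nlinarith
    calc Real.sqrt ((2 * d + 1) / y) ≤ Real.sqrt ((1 / 12) ^ 2) := Real.sqrt_le_sqrt hq
      _ = 1 / 12 := Real.sqrt_sq (by norm_num)
  obtain ⟨s, hs0, hs12, hsq⟩ : ∃ s : ℝ, 0 < s ∧ s ≤ 1 / 12 ∧ Real.sqrt ((2 * d + 1) / y) = s :=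
    ⟨_, Real.sqrt_pos.2 (by positivity), hs12, rfl⟩
  rw [hsq] at htail ⊢
  obtain ⟨r, hr⟩ : ∃ r : ℝ, 2 * s = r := ⟨_, rfl⟩
  rw [hr] at htail
  have hr0 : 0 < r := by rw [← hr]; positivity
  have hr6 : r ≤ 1 / 6 := by rw [← hr]; linarith
  obtain ⟨ρ, hρ⟩ : ∃ ρ : ℝ, (6 * r)⁻¹ = ρ := ⟨_, rfl⟩
  have hρ0 : 0 < ρ := by rw [← hρ]; positivity
  have hρ1 : 1 ≤ ρ := by rw [← hρ, one_le_inv₀ (by positivity)]; linarith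
  have hrρ : r * ρ = 1 / 6 := by rw [← hρ]; field_simp
  -- tails
  obtain ⟨t, ht⟩ : ∃ t : ℕ → ℝ, (fun j => 1 - ∑ k ∈ range j, pulledBlockLaw (d + 1) y k) = t := ⟨_, rfl⟩
  have htnn : ∀ j, 0 ≤ t j := fun j => by rw [← ht]; exact (htail j).1
  have htle : ∀ j, t j ≤ (6 / 5) * s⁻¹ * r ^ j := fun j => by rw [← ht]; exact (htail j).2
  have hsr : s⁻¹ * r = 2 := by rw [← hr]; field_simp
  -- the `G` series: `g_j = t_{j+2} ρ^{j+1} ≤ (2/5)(1/6)^j`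
  have hgle : ∀ j, t (j + 2) * ρ ^ (j + 1) ≤ (2 / 5) * (1 / 6) ^ j := by
    intro j
    calc t (j + 2) * ρ ^ (j + 1) ≤ (6 / 5) * s⁻¹ * r ^ (j + 2) * ρ ^ (j + 1) :=
          mul_le_mul_of_nonneg_right (htle (j + 2)) (by positivity)
      _ = (6 / 5) * (s⁻¹ * r) * ((r * ρ) ^ (j + 1)) := by ring
      _ = (2 / 5) * (1 / 6) ^ j := by rw [hsr, hrρ, pow_succ]; ring
  have hgnn : ∀ j, 0 ≤ t (j + 2) * ρ ^ (j + 1) := fun j => mul_nonneg (htnn _) (by positivity)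
  have hggeo : HasSum (fun j : ℕ => (2 / 5 : ℝ) * (1 / 6) ^ j) ((2 / 5) * (1 - 1 / 6)⁻¹) :=
    (hasSum_geometric_of_lt_one (by norm_num) (by norm_num)).mul_left _
  have hgsum : Summable fun j => t (j + 2) * ρ ^ (j + 1) := hggeo.summable.of_nonneg_of_le hgnn hgle
  set G : ℝ := ∑' j, t (j + 2) * ρ ^ (j + 1) with hGdef
  have hG : HasSum (fun j => t (j + 2) * ρ ^ (j + 1)) G := hgsum.hasSum
  have hGle : G ≤ 12 / 25 := by
    calc G ≤ ∑' j : ℕ, (2 / 5 : ℝ) * (1 / 6) ^ j := hgsum.tsum_le_tsum hgle hggeo.summable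
      _ = (2 / 5) * (1 - 1 / 6)⁻¹ := hggeo.tsum_eq
      _ = 12 / 25 := by norm_num
  -- the `H` series: `h_j = t_{j+2} Σ_{l≤j} ρ^l ≤ t_{j+2} 2^j ρ^j ≤ (2/5)(1/3)^j`
  have hsuml : ∀ j, ∑ l ∈ range (j + 1), ρ ^ l ≤ 2 ^ j * ρ ^ j := by
    intro j
    calc ∑ l ∈ range (j + 1), ρ ^ l ≤ ∑ _l ∈ range (j + 1), ρ ^ j :=
          Finset.sum_le_sum fun l hl => pow_le_pow_right₀ hρ1 (Nat.lt_succ_iff.1 (Finset.mem_range.1 hl))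
      _ = (j + 1 : ℕ) * ρ ^ j := by rw [Finset.sum_const, Finset.card_range, nsmul_eq_mul]
      _ ≤ 2 ^ j * ρ ^ j := by
          refine mul_le_mul_of_nonneg_right ?_ (by positivity)
          exact_mod_cast Nat.succ_le_of_lt (Nat.lt_two_pow_self)
  have hhle : ∀ j, t (j + 2) * ∑ l ∈ range (j + 1), ρ ^ l ≤ (2 / 5) * (1 / 3) ^ j := by
    intro j
    calc t (j + 2) * ∑ l ∈ range (j + 1), ρ ^ l ≤ (6 / 5) * s⁻¹ * r ^ (j + 2) * (2 ^ j * ρ ^ j) :=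
          mul_le_mul (htle (j + 2)) (hsuml j) (Finset.sum_nonneg fun l _ => by positivity) (by positivity)
      _ = (6 / 5) * (s⁻¹ * r) * r * (2 * (r * ρ)) ^ j := by ring
      _ = (12 / 5) * r * (1 / 3) ^ j := by rw [hsr, hrρ]; ring
      _ ≤ (12 / 5) * (1 / 6) * (1 / 3) ^ j := by
          have : (12 / 5 : ℝ) * r ≤ (12 / 5) * (1 / 6) := by linarith
          exact mul_le_mul_of_nonneg_right this (by positivity)
      _ = (2 / 5) * (1 / 3) ^ j := by ring
  have hhnn : ∀ j, 0 ≤ t (j + 2) * ∑ l ∈ range (j + 1), ρ ^ l := fun j =>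
    mul_nonneg (htnn _) (Finset.sum_nonneg fun l _ => by positivity)
  have hhgeo : HasSum (fun j : ℕ => (2 / 5 : ℝ) * (1 / 3) ^ j) ((2 / 5) * (1 - 1 / 3)⁻¹) :=
    (hasSum_geometric_of_lt_one (by norm_num) (by norm_num)).mul_left _
  have hhsum : Summable fun j => t (j + 2) * ∑ l ∈ range (j + 1), ρ ^ l := hhgeo.summable.of_nonneg_of_le hhnn hhle
  set H : ℝ := ∑' j, t (j + 2) * ∑ l ∈ range (j + 1), ρ ^ l with hHdef
  have hH : HasSum (fun j => t (j + 2) * ∑ l ∈ range (j + 1), ρ ^ l) H := hhsum.hasSum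
  have hHle : H ≤ 3 / 5 := by
    calc H ≤ ∑' j : ℕ, (2 / 5 : ℝ) * (1 / 3) ^ j := hhsum.tsum_le_tsum hhle hhgeo.summable
      _ = (2 / 5) * (1 - 1 / 3)⁻¹ := hhgeo.tsum_eq
      _ = 3 / 5 := by norm_num
  have hH0 : 0 ≤ H := by rw [hHdef]; exact tsum_nonneg hhnn
  have hG0 : 0 ≤ G := by rw [hGdef]; exact tsum_nonneg hgnn
  -- apply the conditional every-dimension rate
  have hm1 : 1 ≤ pulledMeanBlock (d + 1) y := one_le_pulledMeanBlock_linear d hy4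
  subst ht
  have hmain := abs_pulledAmp_sub_inv_le_of d hy0 hK hM hρ1 hG (by linarith) hH n
  -- constants: `H/(m(1−G)) ≤ (3/5)/(1·(13/25)) = 15/13 ≤ 6/5`, `ρ⁻¹ = 6r = 12 s`
  have hconst : H / (pulledMeanBlock (d + 1) y * (1 - G)) ≤ 6 / 5 := by
    rw [div_le_iff₀ (by nlinarith)]
    nlinarith
  have hρinv : ρ⁻¹ = 12 * s := by rw [← hρ, inv_inv, ← hr]; ring
  rw [hρinv] at hmain
  calc |pulledAmp (d + 1) y n - (pulledMeanBlock (d + 1) y)⁻¹|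
      ≤ H / (pulledMeanBlock (d + 1) y * (1 - G)) * (12 * s) ^ n := hmain
    _ ≤ (6 / 5) * (12 * s) ^ n := mul_le_mul_of_nonneg_right hconst (by positivity)

/-- The same in terms of the partition function: `|Z^B_n(y) − e^{nλ_B(y)}/m(y)| ≤ (6/5)·(12√((2d+1)/y))ⁿ·e^{nλ_B(y)}`
(`y ≥ 144(2d+1)`, every `n`, every `d`). [cite: MadrasSlade1993, Theorem 4.2.5] -/
theorem abs_pulledBridgeZ_sub_le_linear (d : ℕ) {y : ℝ} (hy : 144 * (2 * d + 1 : ℝ) ≤ y) (n : ℕ) :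
    |pulledBridgeZ (d + 1) n y - Real.exp (n * pulledBridgeFreeEnergy (d + 1) y) / pulledMeanBlock (d + 1) y|
      ≤ (6 / 5) * (12 * Real.sqrt ((2 * d + 1) / y)) ^ n * Real.exp (n * pulledBridgeFreeEnergy (d + 1) y) := by
  have h := abs_pulledAmp_sub_inv_le_linear d hy n
  have hE : 0 < Real.exp (n * pulledBridgeFreeEnergy (d + 1) y) := Real.exp_pos _
  have hA : pulledAmp (d + 1) y n * Real.exp (n * pulledBridgeFreeEnergy (d + 1) y) = pulledBridgeZ (d + 1) n y := by
    rw [pulledAmp, mul_assoc, ← Real.exp_add,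
      show -(n : ℝ) * pulledBridgeFreeEnergy (d + 1) y + n * pulledBridgeFreeEnergy (d + 1) y = 0 by ring,
      Real.exp_zero, mul_one]
  have hid : pulledBridgeZ (d + 1) n y - Real.exp (n * pulledBridgeFreeEnergy (d + 1) y) / pulledMeanBlock (d + 1) y
      = (pulledAmp (d + 1) y n - (pulledMeanBlock (d + 1) y)⁻¹) * Real.exp (n * pulledBridgeFreeEnergy (d + 1) y) := by
    rw [← hA]; ring
  rw [hid, abs_mul, abs_of_pos hE]
  exact mul_le_mul_of_nonneg_right h hE.le

end Literature.Probability.RandomPlanarGeometry.SAW.Zd
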